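import Mathlib
import Literature.NumberTheory.Automorphic.ZhouLegendreGreenValuesProofs
import Literature.NumberTheory.ModularForms.EisensteinE4Hypergeometric
import Literature.NumberTheory.ModularForms.LevelTwoThetaForms
import Literature.Analysis.SpecialFunctions.JacobiThetaAGM
import Literature.Probability.RandomPlanarGeometry.KlebanZagierTheorem2
import Literature.NumberTheory.EllipticCurves.ModularSymbolRep
import HarnessLib

/-!
# The signature-4 Fricke–Klein identity `𝓔(it) = ₂F₁(¼,¾;1;x₄)²` and the level-two axis integral
# `∫_{1/√2}^∞ Δ₂(it)/𝓔(it)² dt = (256π)⁻¹ ∫₀¹ P_{−1/4}(ξ)² dξ`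

[topic NumberTheory/ModularForms]

Support file for `Literature.NumberTheory.Automorphic.Zhou2015_legendreP_sq_integral`
(Zhou 2015, Remark 9, level `2`): the two real-axis inputs of
`GreenLevelTwoEichlerIntegral.higherGreen_cmLevelTwo_of_axis`, namely that `f₂ = Δ₂/𝓔²`
(`LevelTwoThetaForms.fTwo`) is real on the imaginary axis and
`∫_{u>1/√2} f₂(iu) du = (256π)⁻¹ ∫₀¹ P_{−1/4}(ξ)² dξ`.

## Contents (sorry-free)

* §1 `ellipticK x = (π/2)·₂F₁(½,½;1;x)` (`ellipticK_eq_hypergeometric`: Euler's integral and `t = s²`);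
* §2 **Kummer's quadratic transformation** `₂F₁(½,½;1;x) = (1−x/2)^{−1/2}·₂F₁(¼,¾;1;x²/(2−x)²)` on
  `[0,1)` (`hypergeometric_half_eq_kummer`; Andrews–Askey–Roy (3.1.11) at `a = b = ½`), by the
  differential equation: both sides solve `x(1−x)u″ + (1−2x)u′ − u/4 = 0` on `(−½, 1)` and agree at
  `0`, so the Wronskian `x(1−x)W` vanishes identically;
* §3 the axis data `θⱼ(iu)`, `λ(iu)` (`KlebanZagier.lamR`), `𝓔(iu) = (θ₃⁴+θ₄⁴)/2`,
  `Δ₂(iu) = θ₃⁴θ₂⁸θ₄⁴/256` as real numbers (`eisTwo_axisPt`, `deltaTwo_axisPt`, `fTwo_axisPt`), and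
  **`𝓔(iu) = ₂F₁(¼,¾;1;x₄)² = P_{−1/4}(ξ)²`** with `x₄ = λ²/(2−λ)²`, `ξ = 1 − 2x₄` (Jacobi's
  `θ₃² = (2/π)K(λ)` from `JacobiThetaAGM.ellipticK_lamR` + §1 + §2);
* §4 `ξ′ = 8πλ²θ₄⁴/(2−λ)³ = 256π Δ₂/𝓔³` (from `λ′ = −πλθ₄⁴`, `KlebanZagierTheorem2.hasDerivAt_lamR`),
  `λ(i/√2) = 2√2 − 2`, `ξ(1/√2) = 0`, `ξ ↑ 1`, and the substitution
  **`∫_{u>1/√2} Δ₂/𝓔²(iu) du = (256π)⁻¹ ∫₀¹ P_{−1/4}(ξ)² dξ`** (`integral_fTwo_axis`).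

## References

* G. E. Andrews, R. Askey, R. Roy, *Special Functions* (1999), §3.1, (3.1.3)–(3.1.11) (quadratic
  transformations). [cite: AndrewsAskeyRoy1999, §3.1]
* B. C. Berndt, S. Bhargava, F. G. Garvan, *Ramanujan's theories of elliptic functions to
  alternative bases*, Trans. AMS 347 (1995), §9 (signature 4). [folklore]
* Y. Zhou, Ramanujan J. 38 (2015), Remark 9 and eq. (z_Pnu_ratios). [cite: Zhou2015, Remark 9]
-/

noncomputable section

open Real Filter Set MeasureTheory
open UpperHalfPlane hiding I
open scoped Topology

namespace Literature.NumberTheory.ModularForms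

open Literature.NumberTheory.Automorphic (legendreP legendreP_def)
open Literature.NumberTheory.Automorphic.LegendreP (hasSum_ordinaryHypergeometric
  hasDerivAt_ordinaryHypergeometric continuousOn_ordinaryHypergeometric
  euler_integral_ordinaryHypergeometric sq_image_Ioo)
open Literature.Probability.RandomPlanarGeometry (ellipticK)

/-! ## 1. `K(x) = (π/2)·₂F₁(½,½;1;x)` -/

/-- **`ellipticK x = (π/2)·₂F₁(½,½;1;x)`** for `0 ≤ x < 1` (Euler's integral for `₂F₁` with the
substitution `t = s²`). [cite: AndrewsAskeyRoy1999, Thm 2.2.1] -/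
theorem ellipticK_eq_hypergeometric {x : ℝ} (hx0 : 0 ≤ x) (hx1 : x < 1) :
    ellipticK x = π / 2 * ordinaryHypergeometric (1 / 2 : ℝ) (1 / 2) 1 x := by
  have hx : |x| < 1 := by rw [abs_of_nonneg hx0]; exact hx1
  have hE := euler_integral_ordinaryHypergeometric (a := 1 / 2) (b := 1 / 2) (c := 1) (x := x)
    (by norm_num) (by norm_num) hx
  rw [show (1 / 2 : ℝ) - 1 = -(1 / 2) by norm_num, show (1 : ℝ) - 1 / 2 - 1 = -(1 / 2) by norm_num,
    show (1 : ℝ) - 1 / 2 = 1 / 2 by norm_num, Real.Gamma_one_half_eq, Real.Gamma_one, div_one,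
    Real.mul_self_sqrt Real.pi_pos.le] at hE
  -- substitution `t = s²`
  set g : ℝ → ℝ := fun t => t ^ (-(1 / 2) : ℝ) * (1 - t) ^ (-(1 / 2) : ℝ) * (1 - x * t) ^ (-(1 / 2) : ℝ)
    with hg
  have himg := integral_image_eq_integral_abs_deriv_smul (s := Set.Ioo (0 : ℝ) 1)
    (f := fun s : ℝ => s ^ 2) (f' := fun s => 2 * s) measurableSet_Ioo
    (fun s _ => by simpa using (hasDerivAt_pow 2 s).hasDerivWithinAt)
    (fun a ha b hb h => by
      have := congrArg Real.sqrt h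
      simpa only [Real.sqrt_sq ha.1.le, Real.sqrt_sq hb.1.le] using this) g
  rw [sq_image_Ioo] at himg
  have hL : ∫ t in (0 : ℝ)..1, g t = 2 * ellipticK x := by
    rw [intervalIntegral.integral_of_le zero_le_one, integral_Ioc_eq_integral_Ioo, himg, ellipticK,
      intervalIntegral.integral_of_le zero_le_one, integral_Ioc_eq_integral_Ioo, ← integral_const_mul]
    refine setIntegral_congr_fun measurableSet_Ioo fun s hs => ?_
    have hs0 : 0 < s := hs.1
    have h1 : 0 < 1 - s ^ 2 := by nlinarith [hs.2]
    have h2 : 0 < 1 - x * s ^ 2 := by nlinarith [hs.2, mul_nonneg hx0 (sq_nonneg s)]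
    simp only [hg, smul_eq_mul]
    rw [abs_of_pos (by linarith), ← Real.rpow_natCast s 2, ← Real.rpow_mul hs0.le,
      show ((2 : ℕ) : ℝ) * (-(1 / 2) : ℝ) = -1 by norm_num, Real.rpow_neg_one, Real.rpow_natCast,
      Real.rpow_neg h1.le, Real.rpow_neg h2.le, ← Real.sqrt_eq_rpow, ← Real.sqrt_eq_rpow,
      Real.sqrt_mul h1.le]
    field_simp
  rw [hL] at hE
  linarith

/-! ## 2. Kummer's quadratic transformation at `a = b = ½` -/

/-- The multiplier `m(x) = (1 − x/2)^{−1/2}`. [folklore] -/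
def mF (x : ℝ) : ℝ := (1 - x / 2) ^ (-(1 / 2) : ℝ)

/-- The inner variable `y(x) = x²/(2 − x)²`. [folklore] -/
def yF (x : ℝ) : ℝ := x ^ 2 / (2 - x) ^ 2

/-- `y'(x) = 4x/(2−x)³`. [folklore] -/
def y1F (x : ℝ) : ℝ := 4 * x / (2 - x) ^ 3

/-- `y''(x) = 8(1+x)/(2−x)⁴`. [folklore] -/
def y2F (x : ℝ) : ℝ := 8 * (1 + x) / (2 - x) ^ 4

/-- **Kummer's right-hand side** `R(x) := (1 − x/2)^{−1/2}·₂F₁(¼,¾;1;x²/(2−x)²)`. [cite: AndrewsAskeyRoy1999, §3.1] -/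
def kummerR (x : ℝ) : ℝ := mF x * ordinaryHypergeometric (1 / 4 : ℝ) (3 / 4) 1 (yF x)

/-- On `(−1/2, 1)`: `|x| < 1`, `0 < 1 − x/2`, `0 < 2 − x`, `|y(x)| < 1`. [folklore] -/
theorem kummer_domain {x : ℝ} (hx : x ∈ Set.Ioo (-(1 / 2) : ℝ) 1) :
    |x| < 1 ∧ 0 < 1 - x / 2 ∧ 0 < 2 - x ∧ |yF x| < 1 := by
  obtain ⟨h1, h2⟩ := hx
  have h3 : 0 < 2 - x := by linarith
  refine ⟨by rw [abs_lt]; constructor <;> linarith, by linarith, h3, ?_⟩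
  rw [yF, abs_of_nonneg (div_nonneg (sq_nonneg _) (sq_nonneg _)), div_lt_one (pow_pos h3 2)]
  nlinarith

/-- `m' = m/(4(1 − x/2))`. [folklore] -/
theorem hasDerivAt_mF {x : ℝ} (hx : 0 < 1 - x / 2) :
    HasDerivAt mF (mF x / (4 * (1 - x / 2))) x := by
  have hB : HasDerivAt (fun x : ℝ => 1 - x / 2) (-(1 / 2)) x := by
    simpa using ((hasDerivAt_id x).div_const 2).const_sub 1
  have h := hB.rpow_const (p := -(1 / 2)) (Or.inl hx.ne')
  refine (h.congr_of_eventuallyEq (Eventually.of_forall fun u => rfl)).congr_deriv ?_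
  rw [mF, show (-(1 / 2) : ℝ) - 1 = -(1 / 2) - 1 by rfl, Real.rpow_sub_one hx.ne']
  field_simp
  ring

/-- `y' = 4x/(2−x)³`. [folklore] -/
theorem hasDerivAt_yF {x : ℝ} (hx : 0 < 2 - x) : HasDerivAt yF (y1F x) x := by
  have h1 : HasDerivAt (fun x : ℝ => x ^ 2) (2 * x) x := by simpa using hasDerivAt_pow 2 x
  have h2 : HasDerivAt (fun x : ℝ => (2 - x) ^ 2) (2 * (2 - x) * (-1)) x := by
    have := ((hasDerivAt_id x).const_sub (2 : ℝ)).mul ((hasDerivAt_id x).const_sub (2 : ℝ))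
    refine (this.congr_of_eventuallyEq (Eventually.of_forall fun u => by simp [sq])).congr_deriv ?_
    simp; ring
  have h := h1.div h2 (pow_ne_zero 2 hx.ne')
  refine (h.congr_of_eventuallyEq (Eventually.of_forall fun u => rfl)).congr_deriv ?_
  rw [y1F]
  field_simp
  ring

/-- `y'' = 8(1+x)/(2−x)⁴`. [folklore] -/
theorem hasDerivAt_y1F {x : ℝ} (hx : 0 < 2 - x) : HasDerivAt y1F (y2F x) x := by
  have h1 : HasDerivAt (fun x : ℝ => 4 * x) 4 x := by simpa using (hasDerivAt_id x).const_mul 4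
  have h2 : HasDerivAt (fun x : ℝ => (2 - x) ^ 3) (3 * (2 - x) ^ 2 * (-1)) x := by
    have h0 := (hasDerivAt_id x).const_sub (2 : ℝ)
    have := (h0.mul h0).mul h0
    refine (this.congr_of_eventuallyEq (Eventually.of_forall fun u => by
      show (2 - u) ^ 3 = (2 - id u) * (2 - id u) * (2 - id u); simp only [id]; ring)).congr_deriv ?_
    simp; ring
  have h := h1.div h2 (pow_ne_zero 3 hx.ne')
  refine (h.congr_of_eventuallyEq (Eventually.of_forall fun u => rfl)).congr_deriv ?_
  rw [y2F]
  field_simp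
  ring

/-- First and second derivatives of `R = m·G(y)`, `G = ₂F₁(¼,¾;1;·)`. [folklore] -/
theorem kummerR_deriv_data {x : ℝ} (hx : x ∈ Set.Ioo (-(1 / 2) : ℝ) 1) :
    let a := (1 / 4 : ℝ)
    let b := (3 / 4 : ℝ)
    let G := ordinaryHypergeometric a b 1 (yF x)
    let G₁ := a * b / 1 * ordinaryHypergeometric (a + 1) (b + 1) (1 + 1) (yF x)
    let G₂ := a * b / 1 * ((a + 1) * (b + 1) / (1 + 1) *
      ordinaryHypergeometric (a + 1 + 1) (b + 1 + 1) (1 + 1 + 1) (yF x))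
    HasDerivAt kummerR (mF x / (4 * (1 - x / 2)) * G + mF x * (G₁ * y1F x)) x ∧
      HasDerivAt (deriv kummerR)
        ((mF x / (4 * (1 - x / 2))) / (4 * (1 - x / 2)) * G + mF x * 2 / (4 * (1 - x / 2)) ^ 2 * G
          + mF x / (4 * (1 - x / 2)) * (G₁ * y1F x)
          + (mF x / (4 * (1 - x / 2)) * (G₁ * y1F x) + mF x * (G₂ * y1F x * y1F x + G₁ * y2F x))) x := by
  intro a b G G₁ G₂
  obtain ⟨hx1, hB, h2x, hy⟩ := kummer_domain hx
  -- first derivative at every point of the domain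
  have hd1 : ∀ u ∈ Set.Ioo (-(1 / 2) : ℝ) 1, HasDerivAt kummerR
      (mF u / (4 * (1 - u / 2)) * ordinaryHypergeometric a b 1 (yF u) +
        mF u * (a * b / 1 * ordinaryHypergeometric (a + 1) (b + 1) (1 + 1) (yF u) * y1F u)) u := by
    intro u hu
    obtain ⟨-, hBu, h2u, hyu⟩ := kummer_domain hu
    have hG := (hasDerivAt_ordinaryHypergeometric (a := a) (b := b) (c := 1) hyu).comp u (hasDerivAt_yF h2u)
    have hm := hasDerivAt_mF hBu
    have := hm.mul hG
    exact this.congr_of_eventuallyEq (Eventually.of_forall fun v => rfl)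
  refine ⟨hd1 x hx, ?_⟩
  -- second derivative
  have hev : deriv kummerR =ᶠ[𝓝 x] fun u =>
      mF u / (4 * (1 - u / 2)) * ordinaryHypergeometric a b 1 (yF u) +
        mF u * (a * b / 1 * ordinaryHypergeometric (a + 1) (b + 1) (1 + 1) (yF u) * y1F u) := by
    filter_upwards [Ioo_mem_nhds hx.1 hx.2] with u hu using (hd1 u hu).deriv
  have hm := hasDerivAt_mF hB
  have hBd : HasDerivAt (fun u : ℝ => 4 * (1 - u / 2)) (-2) x := by
    have := (((hasDerivAt_id x).div_const 2).const_sub 1).const_mul 4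
    refine (this.congr_of_eventuallyEq (Eventually.of_forall fun v => rfl)).congr_deriv ?_
    simp; ring
  have hq := hm.fun_div hBd (by positivity : (4 : ℝ) * (1 - x / 2) ≠ 0)
  have hG := (hasDerivAt_ordinaryHypergeometric (a := a) (b := b) (c := 1) hy).comp x (hasDerivAt_yF h2x)
  have hG1 := ((hasDerivAt_ordinaryHypergeometric (a := a + 1) (b := b + 1) (c := 1 + 1) hy).comp x
    (hasDerivAt_yF h2x)).const_mul (a * b / 1)
  have hy1 := hasDerivAt_y1F h2x
  have h := (hq.fun_mul hG).fun_add (hm.fun_mul (hG1.fun_mul hy1))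
  refine (h.congr_of_eventuallyEq (hev.trans (Eventually.of_forall fun u => ?_))).congr_deriv ?_
  · simp only [Function.comp_apply]
  · simp only [Function.comp_apply]
    field_simp
    ring

/-- **`R` solves the hypergeometric equation of `₂F₁(½,½;1;·)`**:
`x(1−x)R″ + (1−2x)R′ − R/4 = 0` on `(−1/2, 1)` (it is `4xm/(2−x)²` times the equation of
`₂F₁(¼,¾;1;·)` at `y = x²/(2−x)²`). [cite: AndrewsAskeyRoy1999, §3.1] -/
theorem kummerR_ode {x : ℝ} (hx : x ∈ Set.Ioo (-(1 / 2) : ℝ) 1) :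
    x * (1 - x) * deriv (deriv kummerR) x + (1 - 2 * x) * deriv kummerR x - 1 / 4 * kummerR x = 0 := by
  obtain ⟨hx1, hB, h2x, hy⟩ := kummer_domain hx
  obtain ⟨hd, hdd⟩ := kummerR_deriv_data hx
  have hode := ordinaryHypergeometric_ode (a := 1 / 4) (b := 3 / 4) (c := 1) one_pos hy
  rw [hd.deriv, hdd.deriv, kummerR]
  simp only [yF, y1F, y2F] at hode ⊢
  have h2 : (2 : ℝ) - x ≠ 0 := h2x.ne'
  have hB' : (1 : ℝ) - x / 2 ≠ 0 := hB.ne'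
  linear_combination (norm := skip) (4 * x * mF x / (2 - x) ^ 2) * hode
  field_simp
  ring

/-- `K := ₂F₁(½,½;1;·)` solves the same equation on `(−1, 1)`. [cite: AndrewsAskeyRoy1999, (2.3.5)] -/
theorem hypergeometric_half_ode {x : ℝ} (hx : |x| < 1) :
    x * (1 - x) * deriv (deriv (ordinaryHypergeometric (1 / 2 : ℝ) (1 / 2) 1 : ℝ → ℝ)) x +
      (1 - 2 * x) * deriv (ordinaryHypergeometric (1 / 2 : ℝ) (1 / 2) 1 : ℝ → ℝ) x -
      1 / 4 * ordinaryHypergeometric (1 / 2 : ℝ) (1 / 2) 1 x = 0 := by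
  have hode := ordinaryHypergeometric_ode (a := 1 / 2) (b := 1 / 2) (c := 1) one_pos hx
  have hd1 : ∀ u : ℝ, |u| < 1 → HasDerivAt (ordinaryHypergeometric (1 / 2 : ℝ) (1 / 2) 1 : ℝ → ℝ)
      (1 / 2 * (1 / 2) / 1 * ordinaryHypergeometric (1 / 2 + 1 : ℝ) (1 / 2 + 1) (1 + 1) u) u :=
    fun u hu => hasDerivAt_ordinaryHypergeometric hu
  have hev : deriv (ordinaryHypergeometric (1 / 2 : ℝ) (1 / 2) 1 : ℝ → ℝ) =ᶠ[𝓝 x] fun u =>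
      1 / 2 * (1 / 2) / 1 * ordinaryHypergeometric (1 / 2 + 1 : ℝ) (1 / 2 + 1) (1 + 1) u := by
    have hopen : IsOpen {u : ℝ | |u| < 1} := isOpen_lt continuous_abs continuous_const
    filter_upwards [hopen.mem_nhds hx] with u hu using (hd1 u hu).deriv
  have hd2 := ((hasDerivAt_ordinaryHypergeometric (a := (1 / 2 + 1 : ℝ)) (b := 1 / 2 + 1) (c := 1 + 1) hx).const_mul
    (1 / 2 * (1 / 2) / 1 : ℝ)).congr_of_eventuallyEq hev
  rw [(hd1 x hx).deriv, hd2.deriv]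
  linear_combination hode

/-- `₂F₁(½,½;1;x) > 0` for `0 ≤ x < 1`. [folklore] -/
theorem hypergeometric_half_pos {x : ℝ} (hx0 : 0 ≤ x) (hx1 : x < 1) :
    0 < ordinaryHypergeometric (1 / 2 : ℝ) (1 / 2) 1 x := by
  have hx : |x| < 1 := by rw [abs_of_nonneg hx0]; exact hx1
  have h := hasSum_ordinaryHypergeometric (1 / 2 : ℝ) (1 / 2) 1 hx
  have hcoef : ∀ n, 0 < ordinaryHypergeometricCoefficient (1 / 2 : ℝ) (1 / 2) 1 n := by
    intro n
    rw [ordinaryHypergeometricCoefficient]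
    have ha : 0 < (ascPochhammer ℝ n).eval (1 / 2 : ℝ) := ascPochhammer_pos n _ (by norm_num)
    have hc : 0 < (ascPochhammer ℝ n).eval (1 : ℝ) := ascPochhammer_pos n 1 one_pos
    positivity
  refine lt_of_lt_of_le (hcoef 0) ?_
  have h1 := sum_le_hasSum {0} (fun m _ => mul_nonneg (hcoef m).le (pow_nonneg hx0 m)) h
  simpa using h1

/-- The Wronskian `Z := x(1−x)(K R′ − K′ R)` has zero derivative on `(−1/2, 1)`. [folklore] -/
theorem hasDerivAt_kummer_wronskian {x : ℝ} (hx : x ∈ Set.Ioo (-(1 / 2) : ℝ) 1) :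
    HasDerivAt (fun u => u * (1 - u) * (ordinaryHypergeometric (1 / 2 : ℝ) (1 / 2) 1 u * deriv kummerR u -
      deriv (ordinaryHypergeometric (1 / 2 : ℝ) (1 / 2) 1 : ℝ → ℝ) u * kummerR u)) 0 x := by
  obtain ⟨hx1, hB, h2x, hy⟩ := kummer_domain hx
  set K : ℝ → ℝ := ordinaryHypergeometric (1 / 2 : ℝ) (1 / 2) 1 with hK
  have hKd : HasDerivAt K (deriv K x) x := (hasDerivAt_ordinaryHypergeometric hx1).differentiableAt.hasDerivAt
  have hK2 : HasDerivAt (deriv K) (deriv (deriv K) x) x := by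
    have hopen : IsOpen {u : ℝ | |u| < 1} := isOpen_lt continuous_abs continuous_const
    have hev : deriv K =ᶠ[𝓝 x] fun u =>
        1 / 2 * (1 / 2) / 1 * ordinaryHypergeometric (1 / 2 + 1 : ℝ) (1 / 2 + 1) (1 + 1) u := by
      filter_upwards [hopen.mem_nhds hx1] with u hu using (hasDerivAt_ordinaryHypergeometric hu).deriv
    have hd2 := ((hasDerivAt_ordinaryHypergeometric (a := (1 / 2 + 1 : ℝ)) (b := 1 / 2 + 1) (c := 1 + 1) hx1).const_mul
      (1 / 2 * (1 / 2) / 1 : ℝ)).congr_of_eventuallyEq hev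
    exact hd2.differentiableAt.hasDerivAt
  obtain ⟨hR, hR'⟩ := kummerR_deriv_data hx
  have hRd : HasDerivAt kummerR (deriv kummerR x) x := hR.differentiableAt.hasDerivAt
  have hR2 : HasDerivAt (deriv kummerR) (deriv (deriv kummerR) x) x := hR'.differentiableAt.hasDerivAt
  have hodeK := hypergeometric_half_ode hx1
  have hodeR := kummerR_ode hx
  have hp : HasDerivAt (fun u : ℝ => u * (1 - u)) (1 - 2 * x) x := by
    have := (hasDerivAt_id x).mul ((hasDerivAt_id x).const_sub 1)
    refine (this.congr_of_eventuallyEq (Eventually.of_forall fun u => rfl)).congr_deriv ?_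
    simp; ring
  have h := hp.fun_mul ((hKd.fun_mul hR2).fun_sub (hK2.fun_mul hRd))
  refine (h.congr_of_eventuallyEq (Eventually.of_forall fun u => rfl)).congr_deriv ?_
  linear_combination K x * hodeR - kummerR x * hodeK

/-- **Kummer's quadratic transformation** (`0 ≤ x < 1`):
`₂F₁(½,½;1;x) = (1 − x/2)^{−1/2}·₂F₁(¼,¾;1;x²/(2−x)²)` — Andrews–Askey–Roy (3.1.11)
`₂F₁(a,b;2b;x) = (1−x/2)^{−a}₂F₁(a/2,(a+1)/2;b+½;x²/(2−x)²)` at `a = b = ½`. Proof: the Wronskian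
`x(1−x)W` is constant and vanishes at `x = 0`, so `R/K` is constant on `(0,1)`, `= 1` by continuity at `0`.
[cite: AndrewsAskeyRoy1999, §3.1 (3.1.11)] -/
theorem hypergeometric_half_eq_kummer {x : ℝ} (hx0 : 0 ≤ x) (hx1 : x < 1) :
    ordinaryHypergeometric (1 / 2 : ℝ) (1 / 2) 1 x =
      (1 - x / 2) ^ (-(1 / 2) : ℝ) * ordinaryHypergeometric (1 / 4 : ℝ) (3 / 4) 1 (x ^ 2 / (2 - x) ^ 2) := by
  set K : ℝ → ℝ := ordinaryHypergeometric (1 / 2 : ℝ) (1 / 2) 1 with hK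
  set Z : ℝ → ℝ := fun u => u * (1 - u) * (K u * deriv kummerR u - deriv K u * kummerR u) with hZ
  have h0mem : (0 : ℝ) ∈ Set.Ioo (-(1 / 2) : ℝ) 1 := ⟨by norm_num, by norm_num⟩
  have hZc : ∀ u ∈ Set.Ioo (-(1 / 2) : ℝ) 1, Z u = Z 0 := fun u hu =>
    IsOpen.is_const_of_deriv_eq_zero isOpen_Ioo (convex_Ioo _ _).isPreconnected
      (fun v hv => (hasDerivAt_kummer_wronskian hv).differentiableAt.differentiableWithinAt)
      (fun v hv => (hasDerivAt_kummer_wronskian hv).deriv) hu h0mem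
  have hZ0 : Z 0 = 0 := by simp [hZ]
  have hW : ∀ u ∈ Set.Ioo (0 : ℝ) 1, K u * deriv kummerR u - deriv K u * kummerR u = 0 := by
    intro u hu
    have h := hZc u ⟨by linarith [hu.1], hu.2⟩
    rw [hZ0] at h
    have hne : u * (1 - u) ≠ 0 := by apply mul_ne_zero hu.1.ne'; linarith [hu.2]
    exact (mul_eq_zero.mp h).resolve_left hne
  have hquot : ∀ u ∈ Set.Ioo (0 : ℝ) 1, HasDerivAt (fun v => kummerR v / K v) 0 u := by
    intro u hu
    have hu' : u ∈ Set.Ioo (-(1 / 2) : ℝ) 1 := ⟨by linarith [hu.1], hu.2⟩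
    have hua : |u| < 1 := by rw [abs_of_pos hu.1]; exact hu.2
    have hKd : HasDerivAt K (deriv K u) u := (hasDerivAt_ordinaryHypergeometric hua).differentiableAt.hasDerivAt
    obtain ⟨hR, -⟩ := kummerR_deriv_data hu'
    have hRd : HasDerivAt kummerR (deriv kummerR u) u := hR.differentiableAt.hasDerivAt
    have hpos := hypergeometric_half_pos hu.1.le hu.2
    have h := hRd.div hKd hpos.ne'
    refine h.congr_deriv ?_
    rw [div_eq_zero_iff]
    left
    linear_combination hW u hu
  obtain ⟨c, hc⟩ := IsOpen.exists_is_const_of_deriv_eq_zero (f := fun v => kummerR v / K v)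
    isOpen_Ioo (convex_Ioo (0 : ℝ) 1).isPreconnected
    (fun v hv => (hquot v hv).differentiableAt.differentiableWithinAt)
    (fun v hv => (hquot v hv).deriv)
  -- the constant is `1`: continuity at `0`
  have hK0 : K 0 = 1 := by rw [hK]; exact ordinaryHypergeometric_zero _ _ _
  have hR0 : kummerR 0 = 1 := by simp [kummerR, mF, yF]
  have hcont : ContinuousAt (fun v => kummerR v / K v) 0 := by
    obtain ⟨hR, -⟩ := kummerR_deriv_data h0mem
    have hKc : ContinuousAt K 0 := (hasDerivAt_ordinaryHypergeometric (by simp)).continuousAt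
    exact hR.continuousAt.div hKc (by rw [hK0]; norm_num)
  have hc1 : c = 1 := by
    have hlim : Tendsto (fun v => kummerR v / K v) (𝓝[>] 0) (𝓝 (kummerR 0 / K 0)) :=
      hcont.tendsto.mono_left nhdsWithin_le_nhds
    rw [hR0, hK0, div_one] at hlim
    have hlim' : Tendsto (fun v => kummerR v / K v) (𝓝[>] 0) (𝓝 c) := by
      refine tendsto_const_nhds.congr' ?_
      filter_upwards [Ioo_mem_nhdsGT (show (0 : ℝ) < 1 by norm_num)] with v hv
      exact (hc v hv).symm
    exact tendsto_nhds_unique hlim' hlim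
  rcases hx0.lt_or_eq with hlt | heq
  · have h := hc x ⟨hlt, hx1⟩
    rw [hc1, div_eq_one_iff_eq (hypergeometric_half_pos hx0 hx1).ne'] at h
    have h' : K x = kummerR x := h.symm
    rw [h', kummerR, mF, yF]
  · subst heq
    rw [hK0]; simp

/-! ## 3. The level-two forms on the imaginary axis -/

section Axis

open Literature.NumberTheory.EllipticCurves.JacobiThetaNull (theta2 theta3 theta4 theta3_I_mul_eq_re
  theta2_I_mul_eq_re theta4_I_mul_eq_re theta3_I_mul_re_pos theta2_I_mul_re_pos theta4_I_mul_re_pos)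
open Literature.Probability.RandomPlanarGeometry.KlebanZagier (lamR lamR_mem_Ioo one_sub_lamR hasDerivAt_lamR
  lamR_inv tendsto_lamR_atTop)
open Literature.Analysis.SpecialFunctions (ellipticK_lamR one_sub_sqrt_lamR_div)

/-- `θ₃(iu)` as a real number. [folklore] -/
def th3 (u : ℝ) : ℝ := (theta3 (Complex.I * u)).re

/-- `θ₂(iu)` as a real number. [folklore] -/
def th2 (u : ℝ) : ℝ := (theta2 (Complex.I * u)).re

/-- `θ₄(iu)` as a real number. [folklore] -/
def th4 (u : ℝ) : ℝ := (theta4 (Complex.I * u)).re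

/-- `𝓔(iu) = (θ₃⁴ + θ₄⁴)/2` as a real number. [folklore] -/
def eisTwoR (u : ℝ) : ℝ := (th3 u ^ 4 + th4 u ^ 4) / 2

/-- `Δ₂(iu) = θ₃⁴θ₂⁸θ₄⁴/256` as a real number. [folklore] -/
def deltaTwoR (u : ℝ) : ℝ := th3 u ^ 4 * (th2 u ^ 4) ^ 2 * th4 u ^ 4 / 256

/-- `f₂(iu) = Δ₂/𝓔²(iu)` as a real number. [folklore] -/
def fTwoR (u : ℝ) : ℝ := deltaTwoR u / eisTwoR u ^ 2

/-- Coordinate of `EllipticCurves.ModularForms.axisPt u`: `iu`. [folklore] -/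
theorem coe_axisPt_eq {u : ℝ} (hu : 0 < u) : ((EllipticCurves.ModularForms.axisPt u : ℍ) : ℂ) = Complex.I * u := by
  rw [EllipticCurves.ModularForms.coe_axisPt hu, mul_comm]

/-- `U(iu), V(iu), W(iu)` are the real numbers `θ₃⁴, θ₂⁴, θ₄⁴`. [folklore] -/
theorem thetaUVW_axisPt {u : ℝ} (hu : 0 < u) :
    thetaU (EllipticCurves.ModularForms.axisPt u) = ((th3 u ^ 4 : ℝ) : ℂ) ∧ thetaV (EllipticCurves.ModularForms.axisPt u) = ((th2 u ^ 4 : ℝ) : ℂ) ∧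
      thetaW (EllipticCurves.ModularForms.axisPt u) = ((th4 u ^ 4 : ℝ) : ℂ) := by
  refine ⟨?_, ?_, ?_⟩
  · rw [thetaU_apply, coe_axisPt_eq hu, theta3_I_mul_eq_re hu, th3, Complex.ofReal_pow]
  · rw [thetaV_apply, coe_axisPt_eq hu, theta2_I_mul_eq_re hu, th2, Complex.ofReal_pow]
  · rw [thetaW_apply, coe_axisPt_eq hu, theta4_I_mul_eq_re hu, th4, Complex.ofReal_pow]

/-- **`𝓔(iu)` is real**: `eisTwo (EllipticCurves.ModularForms.axisPt u) = eisTwoR u`. [folklore] -/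
theorem eisTwo_axisPt {u : ℝ} (hu : 0 < u) : eisTwo (EllipticCurves.ModularForms.axisPt u) = (eisTwoR u : ℂ) := by
  obtain ⟨hU, -, hW⟩ := thetaUVW_axisPt hu
  rw [eisTwo, hU, hW, eisTwoR]; push_cast; ring

/-- **`Δ₂(iu)` is real**: `deltaTwo (EllipticCurves.ModularForms.axisPt u) = deltaTwoR u`. [folklore] -/
theorem deltaTwo_axisPt {u : ℝ} (hu : 0 < u) : deltaTwo (EllipticCurves.ModularForms.axisPt u) = (deltaTwoR u : ℂ) := by
  obtain ⟨hU, hV, hW⟩ := thetaUVW_axisPt hu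
  rw [deltaTwo, hU, hV, hW, deltaTwoR]; push_cast; ring

/-- **`f₂(iu)` is real**: `fTwo (EllipticCurves.ModularForms.axisPt u) = fTwoR u`. [folklore] -/
theorem fTwo_axisPt {u : ℝ} (hu : 0 < u) : fTwo (EllipticCurves.ModularForms.axisPt u) = (fTwoR u : ℂ) := by
  rw [fTwo, eisTwo_axisPt hu, deltaTwo_axisPt hu, fTwoR]; push_cast; rfl

/-- Positivity of the thetanulls on the axis. [folklore] -/
theorem th_pos {u : ℝ} (hu : 0 < u) : 0 < th3 u ∧ 0 < th2 u ∧ 0 < th4 u :=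
  ⟨by unfold th3; exact theta3_I_mul_re_pos hu, by unfold th2; exact theta2_I_mul_re_pos hu,
    by unfold th4; exact theta4_I_mul_re_pos hu⟩

/-- `θ₂⁴ = λθ₃⁴` and `θ₄⁴ = (1 − λ)θ₃⁴` on the axis. [folklore] -/
theorem th_pow_four_eq {u : ℝ} (hu : 0 < u) :
    th2 u ^ 4 = lamR u * th3 u ^ 4 ∧ th4 u ^ 4 = (1 - lamR u) * th3 u ^ 4 := by
  have h3 := pow_pos (th_pos hu).1 4
  constructor
  · rw [lamR, ← th2, ← th3, div_mul_cancel₀ _ h3.ne']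
  · rw [one_sub_lamR hu, ← th4, ← th3, div_mul_cancel₀ _ h3.ne']

/-- `𝓔(iu) = θ₃⁴(2 − λ)/2` and `Δ₂(iu) = λ²(1 − λ)θ₃¹⁶/256`. [folklore] -/
theorem eisTwoR_deltaTwoR_eq {u : ℝ} (hu : 0 < u) :
    eisTwoR u = th3 u ^ 4 * (2 - lamR u) / 2 ∧
      deltaTwoR u = lamR u ^ 2 * (1 - lamR u) * (th3 u ^ 4) ^ 4 / 256 := by
  obtain ⟨h2, h4⟩ := th_pow_four_eq hu
  refine ⟨?_, ?_⟩
  · rw [eisTwoR, h4]; ring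
  · rw [deltaTwoR, h2, h4]; ring

/-- `𝓔(iu) > 0`. [folklore] -/
theorem eisTwoR_pos {u : ℝ} (hu : 0 < u) : 0 < eisTwoR u := by
  rw [eisTwoR]; obtain ⟨h3, -, h4⟩ := th_pos hu; positivity

/-- **Jacobi's inversion in hypergeometric form**: `θ₃(iu)² = ₂F₁(½,½;1;λ(iu))`. [cite: AndrewsAskeyRoy1999, Thm 2.2.1] -/
theorem th3_sq_eq_hypergeometric {u : ℝ} (hu : 0 < u) :
    th3 u ^ 2 = ordinaryHypergeometric (1 / 2 : ℝ) (1 / 2) 1 (lamR u) := by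
  obtain ⟨hl0, hl1⟩ := lamR_mem_Ioo hu
  have h := ellipticK_lamR hu
  rw [ellipticK_eq_hypergeometric hl0.le hl1, ← th3] at h
  have hπ : (π : ℝ) ≠ 0 := Real.pi_ne_zero
  have := mul_left_cancel₀ (by positivity : (π : ℝ) / 2 ≠ 0) h
  exact this.symm

/-- The signature-4 variable `x₄ = λ²/(2 − λ)²`. [folklore] -/
def xFour (u : ℝ) : ℝ := yF (lamR u)

/-- `ξ := 1 − 2x₄`, the variable of `P_{−1/4}`. [cite: Zhou2015, eq. (z_Pnu_ratios)] -/
def xiTwo (u : ℝ) : ℝ := 1 - 2 * xFour u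

/-- **Signature-4 Fricke–Klein identity on the axis**: `𝓔(iu) = ₂F₁(¼,¾;1;x₄)²`
(Jacobi's inversion + Kummer's quadratic transformation). [cite: Zhou2015, Remark 9 and eq. (z_Pnu_ratios)] -/
theorem eisTwoR_eq_hypergeometric_sq {u : ℝ} (hu : 0 < u) :
    eisTwoR u = ordinaryHypergeometric (1 / 4 : ℝ) (3 / 4) 1 (xFour u) ^ 2 := by
  obtain ⟨hl0, hl1⟩ := lamR_mem_Ioo hu
  have hE := (eisTwoR_deltaTwoR_eq hu).1
  have hJ := th3_sq_eq_hypergeometric hu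
  rw [hypergeometric_half_eq_kummer hl0.le hl1] at hJ
  have hB : 0 < 1 - lamR u / 2 := by linarith
  set G := ordinaryHypergeometric (1 / 4 : ℝ) (3 / 4) 1 (xFour u) with hG
  have hG' : ordinaryHypergeometric (1 / 4 : ℝ) (3 / 4) 1 (lamR u ^ 2 / (2 - lamR u) ^ 2) = G := rfl
  rw [hG'] at hJ
  have h4 : th3 u ^ 4 = (1 - lamR u / 2) ^ (-(1 : ℝ)) * G ^ 2 := by
    rw [show th3 u ^ 4 = (th3 u ^ 2) ^ 2 by ring, hJ, mul_pow, ← Real.rpow_natCast, ← Real.rpow_mul hB.le]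
    norm_num
  have hB' : (1 : ℝ) - lamR u / 2 ≠ 0 := hB.ne'
  have h2 : (2 : ℝ) - lamR u ≠ 0 := by linarith
  rw [hE, h4, Real.rpow_neg_one]
  field_simp

/-- `x₄ ∈ (0, 1)` hence `ξ ∈ (−1, 1)` on the axis. [folklore] -/
theorem xFour_mem_Ioo {u : ℝ} (hu : 0 < u) : xFour u ∈ Set.Ioo (0 : ℝ) 1 := by
  obtain ⟨hl0, hl1⟩ := lamR_mem_Ioo hu
  refine ⟨?_, ?_⟩
  · rw [xFour, yF]; exact div_pos (pow_pos hl0 2) (pow_pos (by linarith) 2)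
  · have := (kummer_domain (x := lamR u) ⟨by linarith, hl1⟩).2.2.2
    rw [xFour]; exact (abs_lt.mp this).2

/-- **`𝓔(iu) = P_{−1/4}(ξ(u))²`.** [cite: Zhou2015, Remark 9 and eq. (z_Pnu_ratios)] -/
theorem eisTwoR_eq_legendreP_sq {u : ℝ} (hu : 0 < u) : eisTwoR u = legendreP (-1 / 4) (xiTwo u) ^ 2 := by
  rw [eisTwoR_eq_hypergeometric_sq hu, legendreP_def, xiTwo]
  congr 2
  · norm_num
  · norm_num
  · ring

/-! ## 4. The change of variables `ξ = 1 − 2x₄` -/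

/-- **`ξ′(u) = 8πλ²θ₄⁴/(2−λ)³`** (from `λ′ = −πλθ₄⁴`). [folklore] -/
theorem hasDerivAt_xiTwo {u : ℝ} (hu : 0 < u) :
    HasDerivAt xiTwo (8 * π * lamR u ^ 2 * th4 u ^ 4 / (2 - lamR u) ^ 3) u := by
  obtain ⟨hl0, hl1⟩ := lamR_mem_Ioo hu
  have hy := hasDerivAt_yF (x := lamR u) (by linarith)
  have hl := hasDerivAt_lamR hu
  have h := ((hy.comp u hl).const_mul 2).const_sub 1
  refine (h.congr_of_eventuallyEq (Eventually.of_forall fun v => rfl)).congr_deriv ?_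
  rw [y1F, ← th4]
  field_simp
  ring

/-- `ξ′ > 0` on the axis. [folklore] -/
theorem deriv_xiTwo_pos {u : ℝ} (hu : 0 < u) : 0 < 8 * π * lamR u ^ 2 * th4 u ^ 4 / (2 - lamR u) ^ 3 := by
  obtain ⟨hl0, hl1⟩ := lamR_mem_Ioo hu
  have h4 := (th_pos hu).2.2
  have h2 : 0 < 2 - lamR u := by linarith
  positivity

/-- **The integrand in the new variable**: `f₂(iu) = (256π)⁻¹ · P_{−1/4}(ξ(u))² · ξ′(u)`. [folklore] -/
theorem fTwoR_eq {u : ℝ} (hu : 0 < u) :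
    fTwoR u = (256 * π)⁻¹ * (|8 * π * lamR u ^ 2 * th4 u ^ 4 / (2 - lamR u) ^ 3| *
      legendreP (-1 / 4) (xiTwo u) ^ 2) := by
  rw [abs_of_pos (deriv_xiTwo_pos hu), ← eisTwoR_eq_legendreP_sq hu, fTwoR]
  obtain ⟨hE, hD⟩ := eisTwoR_deltaTwoR_eq hu
  obtain ⟨-, h4⟩ := th_pow_four_eq hu
  obtain ⟨hl0, hl1⟩ := lamR_mem_Ioo hu
  have h3 := pow_pos (th_pos hu).1 4
  have h2 : (2 : ℝ) - lamR u ≠ 0 := by linarith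
  have hπ : (π : ℝ) ≠ 0 := Real.pi_ne_zero
  rw [hD, hE, h4]
  field_simp
  ring

/-- `λ(i√2) = 3 − 2√2` (the fixed point of Landen's step `(1−k)/(1+k) = k(2i/y)` at `y = √2`). [folklore] -/
theorem lamR_sqrt_two : lamR (Real.sqrt 2) = 3 - 2 * Real.sqrt 2 := by
  have hs : 0 < Real.sqrt 2 := by positivity
  have hs2 : Real.sqrt 2 * Real.sqrt 2 = 2 := Real.mul_self_sqrt zero_le_two
  have h := one_sub_sqrt_lamR_div hs
  rw [show 2 * (Real.sqrt 2)⁻¹ = Real.sqrt 2 by field_simp; linarith [hs2]] at h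
  obtain ⟨hl0, hl1⟩ := lamR_mem_Ioo hs
  set k := Real.sqrt (lamR (Real.sqrt 2)) with hk
  have hk0 : 0 ≤ k := Real.sqrt_nonneg _
  have hk1 : 0 < 1 + k := by linarith
  rw [div_eq_iff hk1.ne'] at h
  -- `1 − k = k(1+k)` ⇒ `(k+1)² = 2` ⇒ `k = √2 − 1`
  have hk2 : (k + 1) ^ 2 = 2 := by nlinarith
  have hk3 : k + 1 = Real.sqrt 2 := by
    rw [← Real.sqrt_sq (by linarith : 0 ≤ k + 1), hk2]
  have hk4 : k ^ 2 = lamR (Real.sqrt 2) := Real.sq_sqrt hl0.le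
  rw [← hk4, show k = Real.sqrt 2 - 1 by linarith]
  nlinarith [hs2]

/-- **`λ(i/√2) = 2√2 − 2`.** [folklore] -/
theorem lamR_inv_sqrt_two : lamR (Real.sqrt 2)⁻¹ = 2 * Real.sqrt 2 - 2 := by
  rw [lamR_inv (by positivity), lamR_sqrt_two]; ring

/-- `ξ(1/√2) = 0` (`x₄ = 1/2` at the fixed point of `W₂`). [folklore] -/
theorem xiTwo_inv_sqrt_two : xiTwo (Real.sqrt 2)⁻¹ = 0 := by
  rw [xiTwo, xFour, yF, lamR_inv_sqrt_two]
  have hs2 : Real.sqrt 2 * Real.sqrt 2 = 2 := Real.mul_self_sqrt zero_le_two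
  have hne : (2 - (2 * Real.sqrt 2 - 2)) ^ 2 ≠ 0 := by
    apply pow_ne_zero; nlinarith [Real.one_lt_sqrt_two]
  rw [sub_eq_zero, eq_comm, mul_div_assoc', div_eq_one_iff_eq hne]
  nlinarith [hs2]

/-- `ξ < 1` on the axis. [folklore] -/
theorem xiTwo_lt_one {u : ℝ} (hu : 0 < u) : xiTwo u < 1 := by
  rw [xiTwo]; linarith [(xFour_mem_Ioo hu).1]

/-- `ξ` is continuous at every `u > 0`. [folklore] -/
theorem continuousAt_xiTwo {u : ℝ} (hu : 0 < u) : ContinuousAt xiTwo u := (hasDerivAt_xiTwo hu).continuousAt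

/-- `ξ` is strictly increasing on `(0, ∞)`. [folklore] -/
theorem strictMonoOn_xiTwo : StrictMonoOn xiTwo (Set.Ioi 0) := by
  refine strictMonoOn_of_deriv_pos (convex_Ioi 0) (fun u hu => (continuousAt_xiTwo hu).continuousWithinAt)
    fun u hu => ?_
  rw [interior_Ioi] at hu
  rw [(hasDerivAt_xiTwo hu).deriv]
  exact deriv_xiTwo_pos hu

/-- `ξ(u) → 1` as `u → ∞`. [folklore] -/
theorem tendsto_xiTwo_atTop : Tendsto xiTwo atTop (𝓝 1) := by
  have hy : ContinuousAt yF 0 := (hasDerivAt_yF (x := 0) (by norm_num)).continuousAt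
  have h1 : Tendsto xFour atTop (𝓝 (yF 0)) := hy.tendsto.comp tendsto_lamR_atTop
  have h0 : yF 0 = 0 := by simp [yF]
  rw [h0] at h1
  have := (h1.const_mul 2).const_sub 1
  show Tendsto (fun u => 1 - 2 * xFour u) atTop (𝓝 1)
  simpa using this

/-- `ξ` maps `(1/√2, ∞)` onto `(0, 1)`. [folklore] -/
theorem image_xiTwo_Ioi : xiTwo '' Set.Ioi (Real.sqrt 2)⁻¹ = Set.Ioo 0 1 := by
  have ha : 0 < (Real.sqrt 2)⁻¹ := by positivity
  apply Set.Subset.antisymm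
  · rintro y ⟨t, ht, rfl⟩
    have ht0 : 0 < t := ha.trans ht
    refine ⟨?_, xiTwo_lt_one ht0⟩
    rw [← xiTwo_inv_sqrt_two]
    exact strictMonoOn_xiTwo ha ht0 ht
  · intro y hy
    obtain ⟨T₀, hT₀⟩ := (Filter.eventually_atTop.mp
      ((tendsto_xiTwo_atTop.eventually (lt_mem_nhds hy.2)).and (eventually_gt_atTop (Real.sqrt 2)⁻¹)))
    have hT₀' := hT₀ T₀ le_rfl
    have hcont : ContinuousOn xiTwo (Set.Icc (Real.sqrt 2)⁻¹ T₀) := fun t ht =>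
      (continuousAt_xiTwo (ha.trans_le ht.1)).continuousWithinAt
    have hmem : y ∈ Set.Icc (xiTwo (Real.sqrt 2)⁻¹) (xiTwo T₀) := by
      rw [xiTwo_inv_sqrt_two]; exact ⟨hy.1.le, hT₀'.1.le⟩
    obtain ⟨t, ht, hty⟩ := intermediate_value_Icc hT₀'.2.le hcont hmem
    have ht1 : t ≠ (Real.sqrt 2)⁻¹ := by
      rintro rfl
      rw [xiTwo_inv_sqrt_two] at hty
      exact absurd hty hy.1.ne
    exact ⟨t, lt_of_le_of_ne ht.1 (Ne.symm ht1), hty⟩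

/-- **`∫_{1/√2}^∞ Δ₂(iu)/𝓔(iu)² du = (256π)⁻¹ ∫₀¹ P_{−1/4}(ξ)² dξ`** (real form): the change of variables
`ξ = 1 − 2λ²/(2−λ)²`, the level-two instance of the mechanism behind Zhou 2015, Remark 9
(`G₂^{Γ₀(2)}` as `∫₀¹ P_{−1/4}²`). [cite: Zhou2015, Remark 9 and eq. (z_Pnu_ratios)] -/
theorem integral_fTwoR_axis :
    ∫ u in Set.Ioi (Real.sqrt 2)⁻¹, fTwoR u = (256 * π)⁻¹ * ∫ ξ in (0 : ℝ)..1, legendreP (-1 / 4) ξ ^ 2 := by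
  have ha : 0 < (Real.sqrt 2)⁻¹ := by positivity
  have himage := integral_image_eq_integral_abs_deriv_smul (f := xiTwo)
    (f' := fun u => 8 * π * lamR u ^ 2 * th4 u ^ 4 / (2 - lamR u) ^ 3) measurableSet_Ioi
    (fun t ht => (hasDerivAt_xiTwo (ha.trans ht)).hasDerivWithinAt)
    (strictMonoOn_xiTwo.injOn.mono (Set.Ioi_subset_Ioi ha.le))
    (fun ξ => legendreP (-1 / 4) ξ ^ 2)
  rw [image_xiTwo_Ioi] at himage
  rw [intervalIntegral.integral_of_le zero_le_one, integral_Ioc_eq_integral_Ioo, himage,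
    ← integral_const_mul]
  refine setIntegral_congr_fun measurableSet_Ioi fun u hu => ?_
  rw [fTwoR_eq (ha.trans hu), smul_eq_mul]

/-- **The level-two axis integral, complex form** (the hypothesis `hL` of
`GreenLevelTwoEichlerIntegral.higherGreen_cmLevelTwo_of_axis`):
`∫_{u>1/√2} f₂(iu) du = (256π)⁻¹ ∫₀¹ P_{−1/4}(ξ)² dξ`. [cite: Zhou2015, Remark 9] -/
theorem integral_fTwo_axis :
    ∫ u in Set.Ioi (1 / Real.sqrt 2), fTwo (EllipticCurves.ModularForms.axisPt u) =
      ((((256 * π)⁻¹ * ∫ ξ in (0 : ℝ)..1, legendreP (-1 / 4) ξ ^ 2 : ℝ)) : ℂ) := by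
  have ha : 0 < (Real.sqrt 2)⁻¹ := by positivity
  rw [one_div, ← integral_fTwoR_axis, ← integral_complex_ofReal]
  exact setIntegral_congr_fun measurableSet_Ioi fun u hu => fTwo_axisPt (ha.trans hu)

/-- **`f₂` is real on the imaginary axis** (the hypothesis `hr` of `higherGreen_cmLevelTwo_of_axis`).
[folklore] -/
theorem fTwo_axisPt_real : ∀ t : ℝ, 0 < t → fTwo (EllipticCurves.ModularForms.axisPt t) = ((fTwoR t : ℝ) : ℂ) := fun _ ht => fTwo_axisPt ht

end Axis

end Literature.NumberTheory.ModularForms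

end
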